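import Mathlib.FieldTheory.Differential.Basic
import Mathlib.RingTheory.Derivation.Lie
import Mathlib.FieldTheory.PerfectClosure
import HarnessLib

/-!
# Derivations along separable algebraic extensions: uniqueness, existence, commutation

Topic: `Literature/FieldTheory/Separability`. For a separable algebraic extension `E/F`:

* `Derivation.eq_zero_of_forall_algebraMap_eq_zero` — a derivation of `E` (into any `E`-vector
  space) vanishing on `F` vanishes (`0 = D(p(x)) = pᴰ(x) + p'(x)·D(x) = p'(x)·D(x)` for the minimal
  polynomial `p` of `x`, and `p'(x) ≠ 0` by separability); hence two derivations of `E` agreeing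
  on `F` are equal (`Derivation.eq_of_forall_algebraMap_eq`);
* `Derivation.extendFinite d` — for `E/F` finite and `char F = 0`, THE derivation of `E` extending
  `d : F → F` (a repackaging, derivation by derivation, of Mathlib's
  `Differential.differentialFiniteDimensional`), with `extendFinite_algebraMap`, uniqueness
  `eq_extendFinite`, additivity, and
* `extendFinite_commutator` — extensions of commuting derivations commute (their commutator is a
  derivation extending `0`).

[folklore]

## References

* N. Jacobson, *Lectures in Abstract Algebra III*, Ch. IV §7 (derivations of separable extensions).
-/

noncomputable section

namespace Literature.FieldTheory.Separability

open Polynomial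

section Uniqueness

variable {R F E M : Type*} [CommRing R] [Field F] [Field E] [Algebra F E] [Algebra R F] [Algebra R E]
  [IsScalarTower R F E] [AddCommGroup M] [Module E M] [Module F M] [IsScalarTower F E M] [Module R M]
  [IsScalarTower R E M]

omit [IsScalarTower R E M] in
/-- **A derivation of a separable algebraic extension `E/F` vanishing on `F` vanishes.**
[folklore] -/
theorem _root_.Derivation.eq_zero_of_forall_algebraMap_eq_zero [Algebra.IsSeparable F E]
    (D : Derivation R E M) (h : ∀ a : F, D (algebraMap F E a) = 0) : D = 0 := by
  ext x
  have hsep : (minpoly F x).Separable := Algebra.IsSeparable.isSeparable F x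
  have hcomp : D.compAlgebraMap F = 0 := by
    ext a
    exact h a
  have key := D.apply_aeval_eq x (minpoly F x)
  rw [minpoly.aeval, map_zero, hcomp] at key
  have h0 : ((0 : Derivation R F M).mapCoeffs (minpoly F x)) = 0 := by
    ext i
    simp
  rw [h0, map_zero] at key
  simp only [map_zero, zero_add] at key
  have hne : aeval x (derivative (minpoly F x)) ≠ 0 :=
    hsep.aeval_derivative_ne_zero (minpoly.aeval F x)
  rw [Derivation.zero_apply]
  exact (smul_eq_zero.mp key.symm).resolve_left hne

omit [IsScalarTower R E M] in
/-- **Two derivations of a separable algebraic extension agreeing on the base field are equal.**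
[folklore] -/
theorem _root_.Derivation.eq_of_forall_algebraMap_eq [Algebra.IsSeparable F E]
    {D₁ D₂ : Derivation R E M} (h : ∀ a : F, D₁ (algebraMap F E a) = D₂ (algebraMap F E a)) :
    D₁ = D₂ := by
  have := (D₁ - D₂).eq_zero_of_forall_algebraMap_eq_zero (F := F) fun a => by
    rw [Derivation.sub_apply, h a, sub_self]
  exact sub_eq_zero.mp this

end Uniqueness

section Extension

variable {F E : Type*} [Field F] [Field E] [Algebra F E] [FiniteDimensional F E] [CharZero F]

/-- **The extension of a derivation of `F` to a finite extension `E`** (characteristic zero),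
derivation by derivation, through Mathlib's `Differential.differentialFiniteDimensional`.
[folklore] -/
def _root_.Derivation.extendFinite (d : Derivation ℤ F F) : Derivation ℤ E E :=
  @Differential.deriv E _ (@Differential.differentialFiniteDimensional F _ ⟨d⟩ _ E _ _ _)

/-- The extension extends: `D(a) = d(a)` on `F`. [folklore] -/
@[simp] theorem _root_.Derivation.extendFinite_algebraMap (d : Derivation ℤ F F) (a : F) :
    d.extendFinite (algebraMap F E a) = algebraMap F E (d a) := by
  letI : Differential F := ⟨d⟩
  letI : Differential E := Differential.differentialFiniteDimensional F E
  haveI : DifferentialAlgebra F E := Differential.differentialAlgebraFiniteDimensional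
  exact DifferentialAlgebra.deriv_algebraMap a

/-- In characteristic zero `E/F` finite is separable. [folklore] -/
theorem isSeparable_of_finiteDimensional : Algebra.IsSeparable F E := by
  haveI : PerfectField F := PerfectField.ofCharZero
  exact Algebra.IsAlgebraic.isSeparable_of_perfectField

/-- **Uniqueness**: a derivation of `E` extending `d` is `d.extendFinite`. [folklore] -/
theorem _root_.Derivation.eq_extendFinite {d : Derivation ℤ F F} {D : Derivation ℤ E E}
    (h : ∀ a : F, D (algebraMap F E a) = algebraMap F E (d a)) : D = d.extendFinite := by
  haveI := isSeparable_of_finiteDimensional (F := F) (E := E)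
  exact Derivation.eq_of_forall_algebraMap_eq (F := F) fun a => by
    rw [h a, d.extendFinite_algebraMap]

/-- Extension is additive. [folklore] -/
theorem _root_.Derivation.extendFinite_add (d₁ d₂ : Derivation ℤ F F) :
    (d₁ + d₂).extendFinite (E := E) = d₁.extendFinite + d₂.extendFinite := by
  refine (Derivation.eq_extendFinite (fun a => ?_)).symm
  simp [map_add]

/-- Extension of the zero derivation is zero. [folklore] -/
theorem _root_.Derivation.extendFinite_zero : (0 : Derivation ℤ F F).extendFinite (E := E) = 0 :=
  (Derivation.eq_extendFinite (fun a => by simp)).symm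

/-- Extension is compatible with left multiplication by base scalars:
`(c • d)~ = c • d~`. [folklore] -/
theorem _root_.Derivation.extendFinite_smul (c : F) (d : Derivation ℤ F F) :
    (c • d).extendFinite (E := E) = algebraMap F E c • d.extendFinite := by
  refine (Derivation.eq_extendFinite (fun a => ?_)).symm
  simp [Derivation.smul_apply, map_mul, Algebra.smul_def]

/-- **Extensions of commuting derivations commute.** [folklore] -/
theorem _root_.Derivation.extendFinite_commutator (d₁ d₂ : Derivation ℤ F F) :
    ⁅d₁.extendFinite (E := E), d₂.extendFinite (E := E)⁆ = (⁅d₁, d₂⁆).extendFinite := by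
  refine Derivation.eq_extendFinite fun a => ?_
  simp only [Derivation.commutator_apply, Derivation.extendFinite_algebraMap, map_sub]

/-- In particular the extensions of two commuting derivations commute. [folklore] -/
theorem _root_.Derivation.extendFinite_comm {d₁ d₂ : Derivation ℤ F F} (h : ⁅d₁, d₂⁆ = 0) (x : E) :
    d₁.extendFinite (E := E) (d₂.extendFinite x) = d₂.extendFinite (d₁.extendFinite x) := by
  have := congrArg (fun D : Derivation ℤ E E => D x) (Derivation.extendFinite_commutator (E := E) d₁ d₂)
  simp only [Derivation.commutator_apply, h, Derivation.extendFinite_zero, Derivation.zero_apply]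
    at this
  exact sub_eq_zero.mp this

end Extension

end Literature.FieldTheory.Separability
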